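import Summits.BirchSwinnertonDyer.BirchSwinnertonDyer.Theses.ErratumRoadFive
import Summits.BirchSwinnertonDyer.BirchSwinnertonDyer.Theorems.ErratumRoadFiveClassicalValueFromPrint
import HarnessLib

/-!
# Route `ErratumRoadFive` (K2 at `p ≥ 5`): the two NO-ROAD residual cruxes 19282 `OpenInputNotRam`
# and 19624 `RamNoErratumDataAtFive` (and the aside parent 19061 `OpenInputIMC`) BY NAME from the
# VALUE-FREE shape (2.4)∃♭ on classical Heegner data + the route's own published inputs (item 19283)
# + Castella JIMJ 17 (2018) Thms. 2.10–2.11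

Cell `bsd-stepL` (run/shared/lean/pub/bsd-stepL/), seat `bsd-stepL-bdp` (prover g12, 2026-08-26),
`--supports stmt-BirchSwinnertonDyer-19282`. Route-level (by-name) corollaries of the Theses-free
kernel file `Theorems/ErratumRoadFiveClassicalValueFromPrint.lean` (same seat, same day): this module
imports the route file, so it is NOT citable from the route's `closes` (the kernel file is).

* `openInputNotRam_of_publishedInputs_of_pNew_of_imcDivSomeFrame` — item 19282 `OpenInputNotRam`
  (¬(ram) pairs, cw 112 239) ⟸ `PublishedInputsIMCReduction` (item 19283: modularity, GZK, Kolyvagin,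
  Poitou–Tate, local Euler characteristic among its 16 conjuncts) + the reviewed fact
  `thm210_thm211_bdpDisplay_pNew` + (2.4)∃♭ `P2.IMCDivSomeFrameOnTree` on the ¬(ram) pairs.
* `ramNoErratumDataAtFive_of_publishedInputs_of_pNew_of_imcDivSomeFrame` — the D4 crux 19624
  `RamNoErratumDataAtFive` (REST‴: (ram) pairs with no erratum datum, cw 703 204) ⟸ item 19283 + the
  fact + (2.4)∃♭ on its pairs.
* `openInputIMC_of_publishedInputs_of_pNew_of_imcDivSomeFrameAll` — the (now aside) parent 19061
  `OpenInputIMC` ITSELF ⟸ item 19283 + the fact + (2.4)∃♭ on ALL classical data: if one reads K2's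
  open input at classical Heegner fields everywhere, its whole typed content at `p ≥ 5` is ONE
  value-free conjecture-shaped statement (one inclusion of the anticyclotomic IMC for SOME BDP frame) —
  the value at `𝟙` (H2) and the frame's normalisation are no longer inputs anywhere.

HONEST FRAMING: theorems only; CONDITIONAL on (2.4)∃♭ (OPEN, conjecture-tagged, NO announced derivation
at classical data — the erratum road at erratum data, items 19270 ∕ REST‴, is the cell's road of record
on the (ram) atom) and on the cited facts; nothing is booked; no label, tier or census word moves (T7).
-/

set_option autoImplicit false

noncomputable section

open scoped Classical
open Literature.NumberTheory.EllipticCurves Literature.NumberTheory.EllipticCurves.Rank1Residual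
open Literature.NumberTheory.EllipticCurves.Castella2018Exceptional
open Summit.BirchSwinnertonDyer.Rank1Residual Summit.BirchSwinnertonDyer.Rank1Residual.X11b
open Summit.BirchSwinnertonDyer.BirchSwinnertonDyer.Theses

namespace Summit.BirchSwinnertonDyer.BirchSwinnertonDyer.Theorems

/-- **Item 19282 `OpenInputNotRam` from item 19283 + the JIMJ18 fact + (2.4)∃♭ on the ¬(ram) pairs.**
(`openInputNotRam_of_imcDivSomeFrame_of_pNew` with the published inputs unpacked from
`PublishedInputsIMCReduction`.) CONDITIONAL on (2.4)∃♭ there (OPEN); nothing booked.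
[cite: Castella2018Exceptional, Thms. 2.10–2.11 (arXiv:1507.04260 pp. 13–14)]
[cite: Castella2018Erratum, (2.4) (p. 4)] [cite: Castella2018, Thms. 2.3, 3.1, 3.2, §5] -/
theorem openInputNotRam_of_publishedInputs_of_pNew_of_imcDivSomeFrame
    (hF : ErratumRoadFive.PublishedInputsIMCReduction) (hB : thm210_thm211_bdpDisplay_pNew)
    (hDiv : ∀ (W : WeierstrassCurve ℚ) [W.IsElliptic] [W.IsGloballyMinimal] (p : ℕ) [Fact p.Prime],
      ¬ Ram W p → P2.IMCDivSomeFrameOnTree W p) :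
    ErratumRoadFive.OpenInputNotRam := by
  obtain ⟨-, hGZK, -, hnf, -, -, -, -, hKo, -, -, hPT, -, -, hEP, -⟩ := hF
  exact openInputNotRam_of_imcDivSomeFrame_of_pNew hnf hGZK hKo hPT hEP hB hDiv

/-- **The D4 crux 19624 `RamNoErratumDataAtFive` (REST‴) from item 19283 + the JIMJ18 fact + (2.4)∃♭
on its pairs** (`ramNoErratumData_of_imcDivSomeFrame_of_pNew` with the published inputs unpacked from
`PublishedInputsIMCReduction`): on the (ram) pairs with no erratum datum the composite open input is the
value-free IMC-divisibility shape at a classical Heegner field plus print. CONDITIONAL on (2.4)∃♭ there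
(OPEN, no road in print); nothing booked. [cite: Castella2018Exceptional, Thms. 2.10–2.11 (arXiv:1507.04260 pp. 13–14)]
[cite: Castella2018Erratum, (2.4) and Thm. 1.1 (iii)–(iv) (pp. 1, 4)] [cite: Castella2018, Thms. 2.3, 3.1, 3.2, §5] -/
theorem ramNoErratumDataAtFive_of_publishedInputs_of_pNew_of_imcDivSomeFrame
    (hF : ErratumRoadFive.PublishedInputsIMCReduction) (hB : thm210_thm211_bdpDisplay_pNew)
    (hDiv : ∀ (W : WeierstrassCurve ℚ) [W.IsElliptic] [W.IsGloballyMinimal] (p : ℕ) [Fact p.Prime],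
      Ram W p →
      ¬ ((∃ (q : ℕ) (_ : Fact q.Prime), q ≠ 2 ∧ q ≠ p ∧ Mult W q ∧
          ¬ W.HasSplitMultiplicativeReductionAtPrime q ∧ ¬ p ∣ padicValInt q W.minimalDiscriminantInt) ∧
        (∀ P : (W.baseChange ℚ_[p]).toAffine.Point, p • P = 0 → P = 0)) →
      P2.IMCDivSomeFrameOnTree W p) :
    ErratumRoadFive.RamNoErratumDataAtFive := by
  obtain ⟨-, hGZK, -, hnf, -, -, -, -, hKo, -, -, hPT, -, -, hEP, -⟩ := hF
  exact ramNoErratumData_of_imcDivSomeFrame_of_pNew hnf hGZK hKo hPT hEP hB hDiv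

/-- **The parent crux 19061 `OpenInputIMC` from item 19283 + the JIMJ18 fact + (2.4)∃♭ on ALL classical
data** (`openInputOnTreeAt_of_imcDivSomeFrame_of_pNew` at every pair). Not the cell's road of record
on the (ram) atom (that is the erratum road, item 19270 at erratum data); recorded to show that the
value half H2 and the frame normalisation have left the classical road entirely. CONDITIONAL on
(2.4)∃♭ everywhere (OPEN); nothing booked.
[cite: Castella2018Exceptional, Thms. 2.10–2.11 (arXiv:1507.04260 pp. 13–14)]
[cite: Castella2018Erratum, (2.4) (p. 4)] [cite: Castella2018, Thms. 2.3, 3.1, 3.2, §5] -/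
theorem openInputIMC_of_publishedInputs_of_pNew_of_imcDivSomeFrameAll
    (hF : ErratumRoadFive.PublishedInputsIMCReduction) (hB : thm210_thm211_bdpDisplay_pNew)
    (hDiv : ∀ (W : WeierstrassCurve ℚ) [W.IsElliptic] [W.IsGloballyMinimal] (p : ℕ) [Fact p.Prime],
      P2.IMCDivSomeFrameOnTree W p) :
    ErratumRoadFive.OpenInputIMC := by
  obtain ⟨-, hGZK, -, hnf, -, -, -, -, hKo, -, -, hPT, -, -, hEP, -⟩ := hF
  exact fun W _ _ p _ ↦
    openInputOnTreeAt_of_imcDivSomeFrame_of_pNew hnf hGZK hKo hPT hEP hB (hDiv W p)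

end Summit.BirchSwinnertonDyer.BirchSwinnertonDyer.Theorems

end
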